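import Summits.NavierStokesRegularity.OSWSelfSimilar.SheetRSpectrumEvenEndToEnd
import Summits.NavierStokesRegularity.OSWSelfSimilar.SheetRNewtonKantorovichOfRecord
import Summits.NavierStokesRegularity.OSWSelfSimilar.SheetRLiftEvenOfRecord
import HarnessLib

/-!
# Sheet-ℝ spectral certificate (Z3-SR-SPEC, EVEN half): THE EVEN WORD FOR THE OBJECTS OF RECORD — `eigen_set_eq_singleton_of_record` at the
# centre of record `centreOfRecord`, THE certified `δ`, and the even lift of record `liftEOfRecord`, modulo SEVEN named interval sentences

HONEST FRAMING (cell ns-blowup GROUP B «PROFILE SEARCH»; PROFILE-SPEC v1.3 cases Z3-SR-CERT + Z3-SR-SPEC EVEN half; 1-D MODEL (viscous gCLM/OSW sheet on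
`ℝ` at `(a, c_l, ε) = (1/5, 1/2, 1)`, frame `L = 8`); computer-assisted; not Euler/NS; «violates: none — MODEL»).  Nothing here is a statement about
Navier–Stokes; NO enclosure and NO datum is proved here — pure composition (seat ns-blowup-profile-cert-5 g10; HYPOTHESIS-LEDGER v2.3 «OPEN (ii)»), the even
twin of `SheetRCertifiedProfileOfRecordSeven.certifiedProfile_word_ofRecord₇` / `SheetRSpectrumCertifiedProfile`:
cert-5 g9's end-to-end even word `SheetRSpectrumEvenEndToEnd.eigen_set_eq_singleton_of_record` speaks about a centre datum `hc`, a profile `Ω*` given by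
`hcs : IsCentre 8 Ω* Ω*₁ H*`, `Ω* = Ω̄ + prim (der u)` with `‖u‖_E ≤ rE♯₂`, the weak zero `hweak` with `Ω*(X₀) ≠ 0`, an even zero-mass lift `h⁺ ∈ WevenZ`
with `‖h⁺ + 0i‖² ≤ hw2E`, and an instance `[CompleteSpace (WcevenZ h8)]`.  This file DISCHARGES all of these for THE OBJECTS OF RECORD:
* `Ω̄ := centreOfRecord` (selfsim g13, `isCentre_centreOfRecord`), `u := δ` = THE certified correction of cert-5 g8's
  `SheetRNewtonKantorovichOfRecord.existsUnique_weakSolution_ofRecord` (exactly one `δ` in the `rEBR2`-ball solving the linearised weak equation, modulo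
  the four printed Newton–Kantorovich inequalities #5 #6 #7 #8b), `(Ω*₁, H*, hcs, hweak, Ω*(8) ≠ 0)` := cert-2 g8's
  `SheetRSpectrumCertifiedProfile.exists_isCentre_star` (rows #1 #2 #3 #4 #8a #9 kernel), `hu` := `rEBR2 ≤ rE♯₂`;
* `h⁺ := liftEOfRecord` (this seat's `SheetRLiftEvenOfRecord`: rows 14⁺ `liftEOfRecord_mem_WevenZ` and 13⁺ `norm_sq_realE_liftEOfRecord_le` KERNEL);
* `[CompleteSpace (WcevenZ _)]` := `completeSpace_WcevenZ` (discharged inside the proofs; no instance binder in the statements);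
* row 10⁺ TRIMMED (`gardingDataKE_of_isCentre`, even twin of `gardingDataKC_of_isCentre`): of the eight fields of `GardingDataKE` seven hold for every
  centre by `coef_bounds`; what remains is the bare Gårding inequality on zero-mass even tests with `c₂ = 1/5`, `c₁ + γ = 3/20`.
THE WORD (`eigen_set_eq_singleton_ofRecord`, `eigen_iff_eq_half_ofRecord`, `eigen_half_simple_ofRecord`, `translationMode_spans_eigenline_ofRecord`):
under EXACTLY SEVEN named hypotheses — #5 `f ℓ Nmat hN₁ hN₂` · #6 `hKNwB` ·
#7 `hepsNB` · #8b `hηB` (implementation 2's Newton–Kantorovich prints about `baseSolutionOperator`) · 10⁺ `hS1` (the bare even Gårding inequality at the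
centre of record) · 11⁺ `hPD : PointDataE` · 12⁺ `hFD : MixedFarDatum` (keyed on `resolventEven _ _ (gardingDataKE_ofRecord hS1)`) — there is exactly one
`δ` in the `rEBR2`-ball solving the linearised weak equation at `centreOfRecord`, and for `Ω* = centreOfRecord + prim (der δ)` (a centre) and the generator
`T⁺*` of the `Ω*` encoding with the derived datum `gardingDataKE_star_of_centre`: «{σ : Re σ ≥ −3/100 ∧ ∃ v ≠ 0 in D(T⁺*), T⁺*v = σv − 4⟪h⁺,v⟫h⁺} = {½}»,
«`R⁺*(½)h⁺ ≠ 0` spans the eigenline, no generalized eigenvector, and the translation mode `Ω*′` lies on that line» — the same count and tier as the odd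
`certifiedProfile_word_ofRecord₇`.  No definition, no named fact.  WHAT THIS IS NOT: not NS; not a proof that the seven records hold; no number of record
moves; no census word is asserted by this file.
-/

noncomputable section

namespace Summit.NavierStokesRegularity.OSWSelfSimilar
namespace SheetRSpectrumEvenOfRecord

open _root_.MeasureTheory _root_.Set _root_.Filter _root_.Real _root_.Metric Literature.Analysis.Fourier Literature.Analysis.OperatorTheory
  SheetRWeakProfilePV SheetRWeakToStrong SheetREnergyClass SheetRWeightedMeasure SheetREnergySpace SheetRLinearisedTests SheetRTestSpace
  SheetRLinearisedFormBounds SheetRSolutionOperator SheetRComplexPivot SheetRAssemblyOperators SheetRCertificateAssembly SheetRCertificateCoercivity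
  SheetRCertificateAssemblyB SheetRSpectrumCertifiedProfile SheetRFrameCentre SheetRCentreOfRecord SheetRCentreOfRecordValue SheetRFrameCentreResidual
  SheetRPointwiseDatumOfRecord SheetRCertifiedProfileOfRecordSeven SheetRNewtonKantorovichOfRecord SheetREvenTests SheetREvenEnergySpace SheetREvenForms
  SheetREvenPairUniqueness SheetREvenResolvent SheetREvenClass SheetRResolventEvenClass SheetRGeneratorEvenWeak SheetREvansEven SheetREvenAssemblyOperators
  SheetREvenSecondVariation SheetREvenEnergySpaceOf SheetRTranslationModeWeakEigen SheetREvenCentreReencoding SheetREvenLinearisationPerturbation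
  SheetRSpectrumStepRule SheetRSpectrumEvenWindingLists SheetRSpectrumEvenPointCertificate SheetRSpectrumEvenPointAssembly SheetRSpectrumEvenAssembly
  SheetRResolventEvenConj SheetRSpectrumEvenEndToEnd SheetRLiftEvenOfRecord Complex CertificateViscousSheetR Matrix Finset
open scoped Topology ENNReal ContDiff InnerProductSpace BigOperators

open CertificateViscousSheetRSpectrum (c1 c2 gamma)
open CertificateViscousSheetRSpectrumEven (DeltaE hw2E)

/-! ### §1 Row 10⁺ trimmed: an even Gårding datum from a centre and the bare inequality -/

/-- **`GardingDataKE` FROM A CENTRE AND THE BARE EVEN GÅRDING INEQUALITY.**  For any centre `Ω` (`IsCentre L Ω Ω₁ H₀`), any bounded `K : EspE L → W L`,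
any `c > 0` and `m`: the measurability and growth fields of `GardingDataKE L _ (drift a Ω) (potential L λ Ω) K D₀ D₁ V₀ c m` hold with
`D₀ = |a|·√(π/4L)·(∫ w Ω²)^{1/2}`, `D₁ = ½`, `V₀ = 1 + H₀ + |λ|` (`SheetRCertificateAssembly.coef_bounds`), so the datum IS its `garding` field (the
inequality on zero-mass even tests).  Even twin of `SheetRCertifiedProfileOfRecordSeven.gardingDataKC_of_isCentre`.  MODEL frame; not NS. [folklore] -/
theorem gardingDataKE_of_isCentre {L : ℝ} (hL : 0 < L) (lam a : ℝ) {Ω Ω₁ : ℝ → ℝ} {H₀ : ℝ} (hc : IsCentre L Ω Ω₁ H₀)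
    (K : EspE L hL →L[ℝ] W L) {c : ℝ} (m : ℝ) (hcpos : 0 < c)
    (hg : ∀ vp : testSpaceE0,
      c * (∫ ξ, (L ^ 2 + ξ ^ 2) * vp.1.2 ξ ^ 2) + m * ∫ ξ, (L ^ 2 + ξ ^ 2) * vp.1.1 ξ ^ 2 ≤
        linForm L (drift a Ω) (potential L lam Ω) vp.1.1 vp.1.2 vp.1.1 vp.1.2
          + ∫ y, (L ^ 2 + y ^ 2) * (((K (jmapE hL vp) : W L) : ℝ → ℝ) y * vp.1.1 y)) :
    GardingDataKE L hL (drift a Ω) (potential L lam Ω) K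
      (|a| * (Real.sqrt (π / (4 * L)) * Real.sqrt (∫ y, (L ^ 2 + y ^ 2) * Ω y ^ 2))) (1 / 2) (1 + H₀ + |lam|) c m := by
  obtain ⟨hdm, hVm, hd, hV⟩ := coef_bounds hL lam a hc
  exact
    { d_meas := hdm
      V_meas := hVm
      D₀_nonneg := by positivity
      D₁_nonneg := by norm_num
      d_le := fun ξ => by rw [one_div_mul_eq_div]; linarith [hd ξ]
      V_le := hV
      c_pos := hcpos
      garding := hg }

/-- **ROW 10⁺ FOR THE CENTRE AND EVEN LIFT OF RECORD**: the (S1⁺) datum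
`GardingDataKE 8 _ (drift (1/5) Ω̄) (potential 8 4 Ω̄) (−PopCĒ + 4⟪h⁺, ιEE·⟫h⁺) D₀ ½ V₀ (1/5) (3/20)` at `Ω̄ = centreOfRecord`, `h⁺ = liftEOfRecord`, from the bare
Gram-certified inequality on zero-mass even tests (`c₂ = 1/5`, `c₁ + γ = 3/20`; interval arithmetic of record: `CertificateViscousSheetRSpectrumEven` ∥
`…SpectrumEvenB`).  MODEL frame; not NS. [folklore] -/
theorem gardingDataKE_ofRecord
    (hg : ∀ vp : testSpaceE0,
      1 / 5 * (∫ ξ, ((8:ℝ) ^ 2 + ξ ^ 2) * vp.1.2 ξ ^ 2) + 3 / 20 * ∫ ξ, ((8:ℝ) ^ 2 + ξ ^ 2) * vp.1.1 ξ ^ 2 ≤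
        linForm 8 (drift (1 / 5) centreOfRecord) (potential 8 4 centreOfRecord) vp.1.1 vp.1.2 vp.1.1 vp.1.2
          + ∫ y, ((8:ℝ) ^ 2 + y ^ 2) *
            ((((-PopCE eight_pos 4 (1 / 5) isCentre_centreOfRecord
                + ((4 : ℝ) • ((innerSL ℝ liftEOfRecord).comp (ιEE eight_pos))).smulRight liftEOfRecord) (jmapE eight_pos vp) : W 8) : ℝ → ℝ) y
              * vp.1.1 y)) :
    GardingDataKE 8 eight_pos (drift (1 / 5) centreOfRecord) (potential 8 4 centreOfRecord)
      (-PopCE eight_pos 4 (1 / 5) isCentre_centreOfRecord + ((4 : ℝ) • ((innerSL ℝ liftEOfRecord).comp (ιEE eight_pos))).smulRight liftEOfRecord)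
      (|(1 / 5 : ℝ)| * (Real.sqrt (π / (4 * 8)) * Real.sqrt (∫ y, ((8:ℝ) ^ 2 + y ^ 2) * centreOfRecord y ^ 2))) (1 / 2) (1 + centreH₀ + |(4:ℝ)|)
      (1 / 5) (3 / 20) :=
  gardingDataKE_of_isCentre eight_pos 4 (1 / 5) isCentre_centreOfRecord _ (3 / 20) (by norm_num) hg

/-- The constant side conditions of the even word at the literals of record: `c₂ ≤ 1/5`. [folklore] -/
theorem c2_le_fifth : ((c2 : ℚ) : ℝ) ≤ 1 / 5 := by norm_num [c2]

/-- … and `c₁ + γ ≤ 3/20`. [folklore] -/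
theorem c1_add_gamma_le : ((c1 : ℚ) : ℝ) + ((gamma : ℚ) : ℝ) ≤ 3 / 20 := by norm_num [c1, gamma]

/-- `−(3/20 − Δ⁺/4) < −3/100` (the derived datum's `m*` clears the abscissa `ra`). [folklore] -/
theorem neg_mstar_ofRecord_lt_ra : -((3 : ℝ) / 20 - ((DeltaE : ℚ) : ℝ) / 4) < ra := neg_mstar_lt_ra' c1_add_gamma_le

/-! ### §2 The even word for the objects of record -/

section Word

variable {n : ℕ} (f : Fin n → W 8) (ℓ : Fin n → Esp 8 eight_pos →L[ℝ] ℝ) (Nmat : Matrix (Fin n) (Fin n) ℝ)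
  (hN₁ : (1 - capMatrix (fun i => baseSolutionOperator (f i)) ℓ) * Nmat = 1)
  (hN₂ : Nmat * (1 - capMatrix (fun i => baseSolutionOperator (f i)) ℓ) = 1)
  (hKNwB : ∀ g : W 8, ‖capInverse (fun i => baseSolutionOperator (f i)) ℓ Nmat (baseSolutionOperator g)‖ ≤ (KNwB : ℝ) * ‖g‖)
  (hepsNB : ∀ u : Esp 8 eight_pos, ‖PopC eight_pos 4 (1 / 5) isCentre_centreOfRecord u - ∑ i, ℓ i u • f i‖ ≤ (epsNBR : ℝ) * ‖u‖)
  (hηB : Real.sqrt (∫ y, ((8:ℝ) ^ 2 + y ^ 2) * (centreOfRecord y + 1 / 2 * y * centreOfRecordDeriv y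
    + 1 / 5 * (∫ s in (0 : ℝ)..y, hilbertTransform centreOfRecord s) * centreOfRecordDeriv y
    - hilbertTransform centreOfRecord y * centreOfRecord y - deriv centreOfRecordDeriv y) ^ 2) ≤ (etaB2 : ℝ))
  (hS1 : ∀ vp : testSpaceE0,
    1 / 5 * (∫ ξ, ((8:ℝ) ^ 2 + ξ ^ 2) * vp.1.2 ξ ^ 2) + 3 / 20 * ∫ ξ, ((8:ℝ) ^ 2 + ξ ^ 2) * vp.1.1 ξ ^ 2 ≤
      linForm 8 (drift (1 / 5) centreOfRecord) (potential 8 4 centreOfRecord) vp.1.1 vp.1.2 vp.1.1 vp.1.2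
        + ∫ y, ((8:ℝ) ^ 2 + y ^ 2) *
          ((((-PopCE eight_pos 4 (1 / 5) isCentre_centreOfRecord
              + ((4 : ℝ) • ((innerSL ℝ liftEOfRecord).comp (ιEE eight_pos))).smulRight liftEOfRecord) (jmapE eight_pos vp) : W 8) : ℝ → ℝ) y
            * vp.1.1 y))
  (hPD : haveI := completeSpace_WcevenZ eight_pos
    PointDataE (resolventEven eight_pos _ (gardingDataKE_ofRecord hS1))
      (realE eight_pos liftEOfRecord (liftEOfRecord_mem_WevenZ eight_pos)) (realE eight_pos liftEOfRecord (liftEOfRecord_mem_WevenZ eight_pos)) 4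
      (evansEven eight_pos _ (gardingDataKE_ofRecord hS1) (innerSL ℂ (realE eight_pos liftEOfRecord (liftEOfRecord_mem_WevenZ eight_pos)))
        (realE eight_pos liftEOfRecord (liftEOfRecord_mem_WevenZ eight_pos)) 4))
  (hFD : haveI := completeSpace_WcevenZ eight_pos
    MixedFarDatum (resolventEven eight_pos _ (gardingDataKE_ofRecord hS1))
      (realE eight_pos liftEOfRecord (liftEOfRecord_mem_WevenZ eight_pos)) (realE eight_pos liftEOfRecord (liftEOfRecord_mem_WevenZ eight_pos)) 1
      ((10075811313 : ℝ) / 10000000000) ((754639259 : ℝ) / 200000000) ((1011518153 : ℝ) / 250000000) ((4049925993 : ℝ) / 1000000000))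

include hN₁ hN₂ hKNwB hepsNB hηB hPD hFD in
/-- **Z3-SR-SPEC EVEN HALF, THE WORD FOR THE OBJECTS OF RECORD (set form).**  Under the seven named hypotheses (module docstring) there is exactly one `δ` in
the `rEBR2`-ball solving the linearised weak equation at `centreOfRecord`, and for `Ω* = centreOfRecord + prim (der δ)` — a centre, `IsCentre 8 Ω* Ω*₁ H*`,
with `‖δ‖_E ≤ rE♯₂` — and `h⁺ = liftEOfRecord`: on `Re σ ≥ −3/100` the set of `σ` carrying a non-zero `v ∈ D(T⁺*)` with `T⁺*v = σv − 4⟪h⁺,v⟫h⁺`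
(`T⁺* := generatorEven` at the derived datum `gardingDataKE_star_of_centre`; in the dictionary `T⁺* + 4⟪h⁺,·⟫h⁺ = −DG⁺(Ω*)|_{E⁺₀}`) is EXACTLY `{½}`.
MODEL statement; not NS. [folklore] -/
theorem eigen_set_eq_singleton_ofRecord :
    ∃ δ : Esp 8 eight_pos, δ ∈ closedBall (0 : Esp 8 eight_pos) (rEBR2 : ℝ) ∧
      (∀ v v₁ : ℝ → ℝ, IsCompactTest v v₁ →
        linForm 8 (drift (1 / 5) centreOfRecord) (potential 8 4 centreOfRecord) (prim (der δ)) (der δ) v v₁ =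
          ∫ y, ((8:ℝ) ^ 2 + y ^ 2) * ((PopFun 8 4 (1 / 5) centreOfRecord centreOfRecordDeriv δ y
            - (centreOfRecord y + 1 / 2 * y * centreOfRecordDeriv y
              + 1 / 5 * (∫ s in (0 : ℝ)..y, hilbertTransform centreOfRecord s) * centreOfRecordDeriv y
              - hilbertTransform centreOfRecord y * centreOfRecord y - deriv centreOfRecordDeriv y)
            - QFun 8 (1 / 5) δ δ y) * v y)) ∧
      (∀ δ' ∈ closedBall (0 : Esp 8 eight_pos) (rEBR2 : ℝ),
        (∀ v v₁ : ℝ → ℝ, IsCompactTest v v₁ →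
          linForm 8 (drift (1 / 5) centreOfRecord) (potential 8 4 centreOfRecord) (prim (der δ')) (der δ') v v₁ =
            ∫ y, ((8:ℝ) ^ 2 + y ^ 2) * ((PopFun 8 4 (1 / 5) centreOfRecord centreOfRecordDeriv δ' y
              - (centreOfRecord y + 1 / 2 * y * centreOfRecordDeriv y
                + 1 / 5 * (∫ s in (0 : ℝ)..y, hilbertTransform centreOfRecord s) * centreOfRecordDeriv y
                - hilbertTransform centreOfRecord y * centreOfRecord y - deriv centreOfRecordDeriv y)
              - QFun 8 (1 / 5) δ' δ' y) * v y)) → δ' = δ) ∧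
      ∃ (Ωs₁ : ℝ → ℝ) (Hs : ℝ) (hcs : IsCentre 8 (fun y => centreOfRecord y + prim (der δ) y) Ωs₁ Hs) (hu : ‖δ‖ ≤ (rEsharp2 : ℝ)),
        {σ : ℂ | ∃ hσ : ra ≤ σ.re, ∃ v : WcevenZ eight_pos, v ≠ 0 ∧
          ∃ hv : v ∈ (generatorEven eight_pos _
              (gardingDataKE_star_of_centre isCentre_centreOfRecord hcs δ (fun _ => rfl) (gardingDataKE_ofRecord hS1) c2_le_fifth hu) σ
              (lt_of_lt_of_le neg_mstar_ofRecord_lt_ra hσ)).domain,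
            generatorEven eight_pos _
                (gardingDataKE_star_of_centre isCentre_centreOfRecord hcs δ (fun _ => rfl) (gardingDataKE_ofRecord hS1) c2_le_fifth hu) σ
                (lt_of_lt_of_le neg_mstar_ofRecord_lt_ra hσ) ⟨v, hv⟩ =
              σ • v - ((4 : ℂ) * innerSL ℂ (realE eight_pos liftEOfRecord (liftEOfRecord_mem_WevenZ eight_pos)) v) •
                realE eight_pos liftEOfRecord (liftEOfRecord_mem_WevenZ eight_pos)} = {(1 : ℂ) / 2} := by
  haveI : CompleteSpace (WcevenZ eight_pos) := completeSpace_WcevenZ eight_pos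
  obtain ⟨δ, ⟨hball, hlin⟩, huniq⟩ := existsUnique_weakSolution_ofRecord f ℓ Nmat hN₁ hN₂ hKNwB hepsNB hηB
  obtain ⟨Ωs₁, Hs, hcs, hweak, hne⟩ := exists_isCentre_star isCentre_centreOfRecord (contDiff_centreOfRecordDeriv (k := 1))
    integrable_weight_residual_sq_centreOfRecord δ hball hlin rEBR2_lt_abs_centreOfRecord_eight
  have hδn : ‖δ‖ ≤ (rEBR2 : ℝ) := by rwa [mem_closedBall, dist_zero_right] at hball
  have hu : ‖δ‖ ≤ (rEsharp2 : ℝ) := hδn.trans rEBR2_le_rEsharp2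
  exact ⟨δ, hball, hlin, fun δ' h1 h2 => huniq δ' ⟨h1, h2⟩, Ωs₁, Hs, hcs, hu,
    eigen_set_eq_singleton_of_record isCentre_centreOfRecord hcs δ (fun _ => rfl) (liftEOfRecord_mem_WevenZ eight_pos)
      (gardingDataKE_ofRecord hS1) c2_le_fifth c1_add_gamma_le hu hPD hFD (norm_sq_realE_liftEOfRecord_le eight_pos) hweak hne⟩

include hN₁ hN₂ hKNwB hepsNB hηB hPD hFD in
/-- **… existence/uniqueness form FOR THE OBJECTS OF RECORD**: same seven hypotheses, same `δ`, some centre structure of `Ω*`: for every `σ` with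
`Re σ ≥ −3/100`, a non-zero eigenvector of `T⁺* + 4⟪h⁺,·⟫h⁺` at `σ` exists iff `σ = ½`.  (The base-point proof arguments threaded through `generatorEven` are
immaterial: selfsim g15's `SheetRGeneratorBasePoint.generatorEven_exists_mem_domain_iff`.)  MODEL statement; not NS. [folklore] -/
theorem eigen_iff_eq_half_ofRecord :
    ∃ δ : Esp 8 eight_pos, δ ∈ closedBall (0 : Esp 8 eight_pos) (rEBR2 : ℝ) ∧
      (∀ v v₁ : ℝ → ℝ, IsCompactTest v v₁ →
        linForm 8 (drift (1 / 5) centreOfRecord) (potential 8 4 centreOfRecord) (prim (der δ)) (der δ) v v₁ =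
          ∫ y, ((8:ℝ) ^ 2 + y ^ 2) * ((PopFun 8 4 (1 / 5) centreOfRecord centreOfRecordDeriv δ y
            - (centreOfRecord y + 1 / 2 * y * centreOfRecordDeriv y
              + 1 / 5 * (∫ s in (0 : ℝ)..y, hilbertTransform centreOfRecord s) * centreOfRecordDeriv y
              - hilbertTransform centreOfRecord y * centreOfRecord y - deriv centreOfRecordDeriv y)
            - QFun 8 (1 / 5) δ δ y) * v y)) ∧
      (∀ δ' ∈ closedBall (0 : Esp 8 eight_pos) (rEBR2 : ℝ),
        (∀ v v₁ : ℝ → ℝ, IsCompactTest v v₁ →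
          linForm 8 (drift (1 / 5) centreOfRecord) (potential 8 4 centreOfRecord) (prim (der δ')) (der δ') v v₁ =
            ∫ y, ((8:ℝ) ^ 2 + y ^ 2) * ((PopFun 8 4 (1 / 5) centreOfRecord centreOfRecordDeriv δ' y
              - (centreOfRecord y + 1 / 2 * y * centreOfRecordDeriv y
                + 1 / 5 * (∫ s in (0 : ℝ)..y, hilbertTransform centreOfRecord s) * centreOfRecordDeriv y
                - hilbertTransform centreOfRecord y * centreOfRecord y - deriv centreOfRecordDeriv y)
              - QFun 8 (1 / 5) δ' δ' y) * v y)) → δ' = δ) ∧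
      ∃ (Ωs₁ : ℝ → ℝ) (Hs : ℝ) (hcs : IsCentre 8 (fun y => centreOfRecord y + prim (der δ) y) Ωs₁ Hs) (hu : ‖δ‖ ≤ (rEsharp2 : ℝ)),
        ∀ σ : ℂ, ∀ hσ : ra ≤ σ.re,
          (∃ v : WcevenZ eight_pos, v ≠ 0 ∧
            ∃ hv : v ∈ (generatorEven eight_pos _
                (gardingDataKE_star_of_centre isCentre_centreOfRecord hcs δ (fun _ => rfl) (gardingDataKE_ofRecord hS1) c2_le_fifth hu) σ
                (lt_of_lt_of_le neg_mstar_ofRecord_lt_ra hσ)).domain,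
              generatorEven eight_pos _
                  (gardingDataKE_star_of_centre isCentre_centreOfRecord hcs δ (fun _ => rfl) (gardingDataKE_ofRecord hS1) c2_le_fifth hu) σ
                  (lt_of_lt_of_le neg_mstar_ofRecord_lt_ra hσ) ⟨v, hv⟩ =
                σ • v - ((4 : ℂ) * innerSL ℂ (realE eight_pos liftEOfRecord (liftEOfRecord_mem_WevenZ eight_pos)) v) •
                  realE eight_pos liftEOfRecord (liftEOfRecord_mem_WevenZ eight_pos)) ↔ σ = (1 : ℂ) / 2 := by
  haveI : CompleteSpace (WcevenZ eight_pos) := completeSpace_WcevenZ eight_pos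
  obtain ⟨δ, ⟨hball, hlin⟩, huniq⟩ := existsUnique_weakSolution_ofRecord f ℓ Nmat hN₁ hN₂ hKNwB hepsNB hηB
  obtain ⟨Ωs₁, Hs, hcs, hweak, hne⟩ := exists_isCentre_star isCentre_centreOfRecord (contDiff_centreOfRecordDeriv (k := 1))
    integrable_weight_residual_sq_centreOfRecord δ hball hlin rEBR2_lt_abs_centreOfRecord_eight
  have hδn : ‖δ‖ ≤ (rEBR2 : ℝ) := by rwa [mem_closedBall, dist_zero_right] at hball
  have hu : ‖δ‖ ≤ (rEsharp2 : ℝ) := hδn.trans rEBR2_le_rEsharp2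
  exact ⟨δ, hball, hlin, fun δ' h1 h2 => huniq δ' ⟨h1, h2⟩, Ωs₁, Hs, hcs, hu, fun σ hσ =>
    eigen_iff_eq_half_of_record isCentre_centreOfRecord hcs δ (fun _ => rfl) (liftEOfRecord_mem_WevenZ eight_pos)
      (gardingDataKE_ofRecord hS1) c2_le_fifth c1_add_gamma_le hu hPD hFD (norm_sq_realE_liftEOfRecord_le eight_pos) hweak hne hσ⟩

include hN₁ hN₂ hKNwB hepsNB hηB hPD hFD in
/-- **… simplicity at `½` and the translation mode, FOR THE OBJECTS OF RECORD.**  Same seven hypotheses, same `δ` (the unique one), some centre structure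
`(Ω*₁, H*)` of `Ω* = centreOfRecord + prim (der δ)`: `R⁺*(½)(h⁺+0i) ≠ 0`; the eigenvectors of `T⁺* + 4⟪h⁺,·⟫h⁺` at `½` are exactly its complex multiples;
there is no generalized eigenvector over a non-zero eigenvector (algebraically simple); and the translation mode — some `P ∈ EspE` with `profile P = Ω*′`,
`cplxE P ≠ 0` — lies on that eigenline.  MODEL statement; not NS. [folklore] -/
theorem eigen_half_simple_ofRecord :
    ∃ δ : Esp 8 eight_pos, δ ∈ closedBall (0 : Esp 8 eight_pos) (rEBR2 : ℝ) ∧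
      (∀ v v₁ : ℝ → ℝ, IsCompactTest v v₁ →
        linForm 8 (drift (1 / 5) centreOfRecord) (potential 8 4 centreOfRecord) (prim (der δ)) (der δ) v v₁ =
          ∫ y, ((8:ℝ) ^ 2 + y ^ 2) * ((PopFun 8 4 (1 / 5) centreOfRecord centreOfRecordDeriv δ y
            - (centreOfRecord y + 1 / 2 * y * centreOfRecordDeriv y
              + 1 / 5 * (∫ s in (0 : ℝ)..y, hilbertTransform centreOfRecord s) * centreOfRecordDeriv y
              - hilbertTransform centreOfRecord y * centreOfRecord y - deriv centreOfRecordDeriv y)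
            - QFun 8 (1 / 5) δ δ y) * v y)) ∧
      (∀ δ' ∈ closedBall (0 : Esp 8 eight_pos) (rEBR2 : ℝ),
        (∀ v v₁ : ℝ → ℝ, IsCompactTest v v₁ →
          linForm 8 (drift (1 / 5) centreOfRecord) (potential 8 4 centreOfRecord) (prim (der δ')) (der δ') v v₁ =
            ∫ y, ((8:ℝ) ^ 2 + y ^ 2) * ((PopFun 8 4 (1 / 5) centreOfRecord centreOfRecordDeriv δ' y
              - (centreOfRecord y + 1 / 2 * y * centreOfRecordDeriv y
                + 1 / 5 * (∫ s in (0 : ℝ)..y, hilbertTransform centreOfRecord s) * centreOfRecordDeriv y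
                - hilbertTransform centreOfRecord y * centreOfRecord y - deriv centreOfRecordDeriv y)
              - QFun 8 (1 / 5) δ' δ' y) * v y)) → δ' = δ) ∧
      ∃ (Ωs₁ : ℝ → ℝ) (Hs : ℝ) (hcs : IsCentre 8 (fun y => centreOfRecord y + prim (der δ) y) Ωs₁ Hs) (hu : ‖δ‖ ≤ (rEsharp2 : ℝ)),
        resolventEven eight_pos _
            (gardingDataKE_star_of_centre isCentre_centreOfRecord hcs δ (fun _ => rfl) (gardingDataKE_ofRecord hS1) c2_le_fifth hu) ((1 : ℂ) / 2)
            (realE eight_pos liftEOfRecord (liftEOfRecord_mem_WevenZ eight_pos)) ≠ 0 ∧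
        (∀ v : WcevenZ eight_pos,
          (∃ hv : v ∈ (generatorEven eight_pos _
              (gardingDataKE_star_of_centre isCentre_centreOfRecord hcs δ (fun _ => rfl) (gardingDataKE_ofRecord hS1) c2_le_fifth hu) ((1 : ℂ) / 2)
              (lt_trans neg_mstar_ofRecord_lt_ra ra_lt_half_re)).domain,
            generatorEven eight_pos _
                (gardingDataKE_star_of_centre isCentre_centreOfRecord hcs δ (fun _ => rfl) (gardingDataKE_ofRecord hS1) c2_le_fifth hu) ((1 : ℂ) / 2)
                (lt_trans neg_mstar_ofRecord_lt_ra ra_lt_half_re) ⟨v, hv⟩ =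
              ((1 : ℂ) / 2) • v - ((4 : ℂ) * innerSL ℂ (realE eight_pos liftEOfRecord (liftEOfRecord_mem_WevenZ eight_pos)) v) •
                realE eight_pos liftEOfRecord (liftEOfRecord_mem_WevenZ eight_pos)) ↔
          ∃ t : ℂ, v = t • resolventEven eight_pos _
            (gardingDataKE_star_of_centre isCentre_centreOfRecord hcs δ (fun _ => rfl) (gardingDataKE_ofRecord hS1) c2_le_fifth hu) ((1 : ℂ) / 2)
            (realE eight_pos liftEOfRecord (liftEOfRecord_mem_WevenZ eight_pos))) ∧
        (∀ δ₀ : WcevenZ eight_pos, δ₀ ≠ 0 →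
          (∃ hv : δ₀ ∈ (generatorEven eight_pos _
              (gardingDataKE_star_of_centre isCentre_centreOfRecord hcs δ (fun _ => rfl) (gardingDataKE_ofRecord hS1) c2_le_fifth hu) ((1 : ℂ) / 2)
              (lt_trans neg_mstar_ofRecord_lt_ra ra_lt_half_re)).domain,
            generatorEven eight_pos _
                (gardingDataKE_star_of_centre isCentre_centreOfRecord hcs δ (fun _ => rfl) (gardingDataKE_ofRecord hS1) c2_le_fifth hu) ((1 : ℂ) / 2)
                (lt_trans neg_mstar_ofRecord_lt_ra ra_lt_half_re) ⟨δ₀, hv⟩ =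
              ((1 : ℂ) / 2) • δ₀ - ((4 : ℂ) * innerSL ℂ (realE eight_pos liftEOfRecord (liftEOfRecord_mem_WevenZ eight_pos)) δ₀) •
                realE eight_pos liftEOfRecord (liftEOfRecord_mem_WevenZ eight_pos)) →
          ¬ ∃ δ₁ : WcevenZ eight_pos, ∃ hv : δ₁ ∈ (generatorEven eight_pos _
              (gardingDataKE_star_of_centre isCentre_centreOfRecord hcs δ (fun _ => rfl) (gardingDataKE_ofRecord hS1) c2_le_fifth hu) ((1 : ℂ) / 2)
              (lt_trans neg_mstar_ofRecord_lt_ra ra_lt_half_re)).domain,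
            generatorEven eight_pos _
                (gardingDataKE_star_of_centre isCentre_centreOfRecord hcs δ (fun _ => rfl) (gardingDataKE_ofRecord hS1) c2_le_fifth hu) ((1 : ℂ) / 2)
                (lt_trans neg_mstar_ofRecord_lt_ra ra_lt_half_re) ⟨δ₁, hv⟩ =
              ((1 : ℂ) / 2) • δ₁ - ((4 : ℂ) * innerSL ℂ (realE eight_pos liftEOfRecord (liftEOfRecord_mem_WevenZ eight_pos)) δ₁) •
                realE eight_pos liftEOfRecord (liftEOfRecord_mem_WevenZ eight_pos) + δ₀) ∧
        ∃ (P : EspE 8 eight_pos) (t : ℂ), profile P = deriv (fun y => centreOfRecord y + prim (der δ) y) ∧ cplxE eight_pos P ≠ 0 ∧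
          cplxE eight_pos P = t • resolventEven eight_pos _
            (gardingDataKE_star_of_centre isCentre_centreOfRecord hcs δ (fun _ => rfl) (gardingDataKE_ofRecord hS1) c2_le_fifth hu) ((1 : ℂ) / 2)
            (realE eight_pos liftEOfRecord (liftEOfRecord_mem_WevenZ eight_pos)) := by
  haveI : CompleteSpace (WcevenZ eight_pos) := completeSpace_WcevenZ eight_pos
  obtain ⟨δ, ⟨hball, hlin⟩, huniq⟩ := existsUnique_weakSolution_ofRecord f ℓ Nmat hN₁ hN₂ hKNwB hepsNB hηB
  obtain ⟨Ωs₁, Hs, hcs, hweak, hne⟩ := exists_isCentre_star isCentre_centreOfRecord (contDiff_centreOfRecordDeriv (k := 1))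
    integrable_weight_residual_sq_centreOfRecord δ hball hlin rEBR2_lt_abs_centreOfRecord_eight
  have hδn : ‖δ‖ ≤ (rEBR2 : ℝ) := by rwa [mem_closedBall, dist_zero_right] at hball
  have hu : ‖δ‖ ≤ (rEsharp2 : ℝ) := hδn.trans rEBR2_le_rEsharp2
  obtain ⟨h0, hline, hjordan⟩ := eigen_half_simple_of_record isCentre_centreOfRecord hcs δ (fun _ => rfl) (liftEOfRecord_mem_WevenZ eight_pos)
    (gardingDataKE_ofRecord hS1) c2_le_fifth c1_add_gamma_le hu hPD hFD (norm_sq_realE_liftEOfRecord_le eight_pos) hweak hne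
  obtain ⟨P, t, hPv, hP0, hPt⟩ := translationMode_spans_eigenline isCentre_centreOfRecord hcs δ (fun _ => rfl)
    (liftEOfRecord_mem_WevenZ eight_pos) (gardingDataKE_ofRecord hS1) c2_le_fifth c1_add_gamma_le hu hPD hFD
    (norm_sq_realE_liftEOfRecord_le eight_pos) hweak hne
  exact ⟨δ, hball, hlin, fun δ' h1 h2 => huniq δ' ⟨h1, h2⟩, Ωs₁, Hs, hcs, hu, h0, hline, hjordan, P, t, hPv, hP0, hPt⟩

include hN₁ hN₂ hKNwB hepsNB hηB hPD hFD in
/-- **The translation mode spans the eigenline at `½`, FOR THE OBJECTS OF RECORD** (packaged corollary): same seven hypotheses, same `δ`, some centre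
structure of `Ω* = centreOfRecord + prim (der δ)`: there is `P ∈ EspE` with `profile P = Ω*′`, `cplxE P ≠ 0`, and `cplxE P = t • R⁺*(½)(h⁺+0i)` for some
`t ∈ ℂ`.  MODEL statement; not NS. [folklore] -/
theorem translationMode_spans_eigenline_ofRecord :
    ∃ δ : Esp 8 eight_pos, δ ∈ closedBall (0 : Esp 8 eight_pos) (rEBR2 : ℝ) ∧
      (∀ v v₁ : ℝ → ℝ, IsCompactTest v v₁ →
        linForm 8 (drift (1 / 5) centreOfRecord) (potential 8 4 centreOfRecord) (prim (der δ)) (der δ) v v₁ =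
          ∫ y, ((8:ℝ) ^ 2 + y ^ 2) * ((PopFun 8 4 (1 / 5) centreOfRecord centreOfRecordDeriv δ y
            - (centreOfRecord y + 1 / 2 * y * centreOfRecordDeriv y
              + 1 / 5 * (∫ s in (0 : ℝ)..y, hilbertTransform centreOfRecord s) * centreOfRecordDeriv y
              - hilbertTransform centreOfRecord y * centreOfRecord y - deriv centreOfRecordDeriv y)
            - QFun 8 (1 / 5) δ δ y) * v y)) ∧
      (∀ δ' ∈ closedBall (0 : Esp 8 eight_pos) (rEBR2 : ℝ),
        (∀ v v₁ : ℝ → ℝ, IsCompactTest v v₁ →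
          linForm 8 (drift (1 / 5) centreOfRecord) (potential 8 4 centreOfRecord) (prim (der δ')) (der δ') v v₁ =
            ∫ y, ((8:ℝ) ^ 2 + y ^ 2) * ((PopFun 8 4 (1 / 5) centreOfRecord centreOfRecordDeriv δ' y
              - (centreOfRecord y + 1 / 2 * y * centreOfRecordDeriv y
                + 1 / 5 * (∫ s in (0 : ℝ)..y, hilbertTransform centreOfRecord s) * centreOfRecordDeriv y
                - hilbertTransform centreOfRecord y * centreOfRecord y - deriv centreOfRecordDeriv y)
              - QFun 8 (1 / 5) δ' δ' y) * v y)) → δ' = δ) ∧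
      ∃ (Ωs₁ : ℝ → ℝ) (Hs : ℝ) (hcs : IsCentre 8 (fun y => centreOfRecord y + prim (der δ) y) Ωs₁ Hs) (hu : ‖δ‖ ≤ (rEsharp2 : ℝ)),
        ∃ (P : EspE 8 eight_pos) (t : ℂ), profile P = deriv (fun y => centreOfRecord y + prim (der δ) y) ∧ cplxE eight_pos P ≠ 0 ∧
          cplxE eight_pos P = t • resolventEven eight_pos _
            (gardingDataKE_star_of_centre isCentre_centreOfRecord hcs δ (fun _ => rfl) (gardingDataKE_ofRecord hS1) c2_le_fifth hu) ((1 : ℂ) / 2)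
            (realE eight_pos liftEOfRecord (liftEOfRecord_mem_WevenZ eight_pos)) := by
  haveI : CompleteSpace (WcevenZ eight_pos) := completeSpace_WcevenZ eight_pos
  obtain ⟨δ, ⟨hball, hlin⟩, huniq⟩ := existsUnique_weakSolution_ofRecord f ℓ Nmat hN₁ hN₂ hKNwB hepsNB hηB
  obtain ⟨Ωs₁, Hs, hcs, hweak, hne⟩ := exists_isCentre_star isCentre_centreOfRecord (contDiff_centreOfRecordDeriv (k := 1))
    integrable_weight_residual_sq_centreOfRecord δ hball hlin rEBR2_lt_abs_centreOfRecord_eight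
  have hδn : ‖δ‖ ≤ (rEBR2 : ℝ) := by rwa [mem_closedBall, dist_zero_right] at hball
  have hu : ‖δ‖ ≤ (rEsharp2 : ℝ) := hδn.trans rEBR2_le_rEsharp2
  obtain ⟨P, t, hPv, hP0, hPt⟩ := translationMode_spans_eigenline isCentre_centreOfRecord hcs δ (fun _ => rfl)
    (liftEOfRecord_mem_WevenZ eight_pos) (gardingDataKE_ofRecord hS1) c2_le_fifth c1_add_gamma_le hu hPD hFD
    (norm_sq_realE_liftEOfRecord_le eight_pos) hweak hne
  exact ⟨δ, hball, hlin, fun δ' h1 h2 => huniq δ' ⟨h1, h2⟩, Ωs₁, Hs, hcs, hu, P, t, hPv, hP0, hPt⟩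

end Word

end SheetRSpectrumEvenOfRecord
end Summit.NavierStokesRegularity.OSWSelfSimilar

end
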